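import Literature.NumberTheory.Transcendental.GammaIsoCrossSaturation
import Literature.NumberTheory.Transcendental.GammaIsoTwistedSteps
import HarnessLib

/-!
# Cross Γ-isomorphisms over Γ-closed bases: Kummer levels and the logarithmic step (two fields)

Two-field port of `GammaIsoTwistedSteps.lean` (M. Bays, J. Kirby, *Pseudo-exponential maps,
variants, and quasiminimality*, Algebra & Number Theory 12 (2018), §3.3, §4.4, Lemma 8.3; the
twisted one-step extension lemmas of the proof of Prop. 11.2 over an isomorphism `σ` of Γ-CLOSED
base Γ-fields), for cross Γ-isomorphisms `GammaField.IsGammaIsoTw₂ σ c c'` between tuples of two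
exponential fields `F₁`, `F₂` (`GammaIsoCross.lean`):

* `aeval_lvGens_iff_of_ringHom₂` — level-`M` transport of relations from a ring homomorphism
  `Ω → F₂` (`Ω ≤ F₁`) extending `σ` and matching level generators;
* `exists_ringHom_adjoin_roots₂`, `exists_ringHom_adjoin_roots_of_indepModPowers₂` — Kummer
  level extensions of embeddings `Ω → F₂` (`Ω ≤ F₁` containing the roots of unity) to
  `Ω(ⁿ√a) → F₂` (Lang, *Algebra*, VI §8);
* `isGammaIsoTw₂_of_adjoinPtFieldHom`, `IsGammaIsoTw₂.append_of_ringHom_adjoin` — cross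
  Γ-isomorphisms from level-`0` embeddings of Kummer-generic tuples (Prop. 3.22, case (EXP));
* the **logarithmic step over a Γ-closed base, across two fields**:
  `IsGammaIsoTw₂.aeval_lvGens_zero_append_single_iff`,
  `IsGammaIsoTw₂.append_single_of_indepModPowers`,
  `IsGammaIsoTw₂.exists_append_single_of_exp_mem_acl_of_indepModPowers`,
  `IsGammaIsoTw₂.exists_append_single_of_exp_mem_acl` (§4.4, proof of Thm 4.17, with the
  normalised bases of `GammaKummerLevels.lean` on the source side).

All proofs are those of `GammaIsoTwistedSteps.lean` / `GammaKummerLevels.lean` /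
`GammaRelativeKummer.lean`, verbatim with the two fields kept apart; the source-side inputs
(normalised bases, roots of unity in the Γ-closed `K₁`, transcendence) and the target-side inputs
(roots in the algebraically closed `F₂`, logarithms from surjectivity of `exp` on `F₂`) are the
tree's one-field lemmas. This is a step of the cross-field `ℵ₀`-saturation over Γ-closed bases
(Kirby 2010 Thm 2.1 across two Zilber fields, for Zilber's categoricity theorem). Everything is
proved; no named fact is introduced.

## References

* M. Bays, J. Kirby, *Pseudo-exponential maps, variants, and quasiminimality*, Algebra & Number
  Theory 12 (2018) 493–549: Def. 3.19, Prop. 3.22, Lemma 4.8, §4.4 (Thm 4.17), Lemma 8.3, Prop. 11.2.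
* S. Lang, *Algebra*, 3rd ed., Springer GTM 211 (2002): VI §8, Thm 8.1.
* J. Kirby, *On quasiminimal excellent classes*, J. Symbolic Logic 75 (2010): Thm 2.1.
-/

noncomputable section

open Set MvPolynomial

universe u

namespace Literature.NumberTheory.Transcendental

namespace GammaField

open Literature.ModelTheory.ExponentialFields.ExponentialRing ZilberHomogeneity ZilberSaturationMain
open Literature.FieldTheory.Kummer

variable {F₁ : Type u} [Field F₁] [CharZero F₁] [Literature.ModelTheory.ExponentialFields.ExponentialRing F₁]
variable {F₂ : Type u} [Field F₂] [CharZero F₂] [Literature.ModelTheory.ExponentialFields.ExponentialRing F₂]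
variable {K₁ : Submodule ℚ F₁} {K₂ : Submodule ℚ F₂} {σ : fieldOf K₁ ≃+* fieldOf K₂} {N n : ℕ}

/-! ### Level-`M` relations from a ring homomorphism extending `σ`, across two fields -/

/-- **Level-`M` transport of relations from an embedding extending `σ`, across two fields.** Let
`Ω` be a field over which `F₁` is an algebra, `ιK : K₁⁰ → Ω` lying over the inclusion
`K₁⁰ ⊆ F₁`, `gv` lying over the level-`M` generators of `x`. If `ψ : Ω → F₂` is a ring
homomorphism with `ψ ∘ ιK = σ` and `ψ (gv s) = lvGens M x' s`, then a polynomial over `K₁⁰`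
vanishes at `lvGens M x` iff its `σ`-transport vanishes at `lvGens M x'`. [folklore] -/
theorem aeval_lvGens_iff_of_ringHom₂ {Ω : Type*} [Field Ω] [Algebra Ω F₁] {m : ℕ} {x : Fin m → F₁}
    {x' : Fin m → F₂} (M : ℕ) (ιK : fieldOf K₁ →+* Ω) (hιK : ∀ k : fieldOf K₁, algebraMap Ω F₁ (ιK k) = k)
    (gv : Fin m ⊕ Fin m → Ω) (hgv : ∀ s, algebraMap Ω F₁ (gv s) = lvGens M x s) (ψ : Ω →+* F₂)
    (hψK : ∀ k : fieldOf K₁, ψ (ιK k) = σ k) (hψv : ∀ s, ψ (gv s) = lvGens M x' s)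
    (P : MvPolynomial (Fin m ⊕ Fin m) (fieldOf K₁)) :
    aeval (lvGens M x) P = 0 ↔
      aeval (lvGens M x') (MvPolynomial.map (σ : fieldOf K₁ →+* fieldOf K₂) P) = 0 := by
  have h1 : algebraMap Ω F₁ (eval₂ ιK gv P) = aeval (lvGens M x) P := by
    rw [eval₂_comp_left, aeval_def]
    congr 1
    · ext k; exact hιK k
    · funext s; exact hgv s
  have h2 : ψ (eval₂ ιK gv P) = aeval (lvGens M x') (MvPolynomial.map (σ : fieldOf K₁ →+* fieldOf K₂) P) := by
    rw [eval₂_comp_left, aeval_def, eval₂_map]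
    congr 1
    · ext k; exact hψK k
    · funext s; exact hψv s
  rw [← h1, ← h2, map_eq_zero_iff _ (algebraMap Ω F₁).injective, map_eq_zero_iff ψ ψ.injective]

/-! ### Kummer level extensions of embeddings into another field -/

section KummerLevels

variable {x : Fin N → F₁} {x' : Fin N → F₂}

omit [CharZero F₂] [Literature.ModelTheory.ExponentialFields.ExponentialRing F₂] in
/-- **Kummer level extension, into another field.** Let `L₁ = K₁⁰(x, exp x) ≤ F₁` be the level-`0`
field of `x` and `τ : L₁ → F₂` a ring homomorphism. If the `exp xᵢ` are independent modulo `n`-th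
powers in `L₁` (`n ≥ 1`) and `K₁` is Γ-closed in the algebraically closed `F₁` (so `L₁` contains
the roots of unity), then for any `n`-th roots `rᵢ ∈ F₁` of `exp xᵢ` and `r'ᵢ ∈ F₂` of
`τ(exp xᵢ)`, `τ` extends to `L₁(r) → F₂` with `rᵢ ↦ r'ᵢ` (`L₁(r) ≅ L₁[T]/(Tᵢⁿ − exp xᵢ)`).
[cite: BaysKirby2018ANT, Prop. 3.22 (proof, case (EXP))] [cite: Lang2002, VI §8 Thm 8.1] -/
theorem exists_ringHom_adjoin_roots₂ [IsAlgClosed F₁] (hK : IsGammaClosed K₁)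
    (τ : adjoinPtField K₁ x →+* F₂) {n : ℕ} (hn : 0 < n) (hind : IndepModPowers n (expGen K₁ x))
    (r : Fin N → F₁) (r' : Fin N → F₂) (hr : ∀ i, r i ^ n = exp (x i))
    (hr' : ∀ i, r' i ^ n = τ (expGen K₁ x i)) :
    ∃ ψ : IntermediateField.adjoin (adjoinPtField K₁ x) (range r) →+* F₂,
      (∀ z : adjoinPtField K₁ x, ψ (algebraMap (adjoinPtField K₁ x) _ z) = τ z) ∧
      ∀ i, ψ ⟨r i, IntermediateField.subset_adjoin _ _ (mem_range_self i)⟩ = r' i := by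
  haveI : NeZero n := ⟨hn.ne'⟩
  obtain ⟨ζ, hζ, hζK⟩ := hK.exists_isPrimitiveRoot hn
  obtain ⟨i₀, hi₀, hi₀K⟩ := hK.exists_sq_eq_neg_one
  let ζ' : adjoinPtField K₁ x := ⟨ζ, mem_adjoinPtField_of_mem_base x hζK⟩
  have hζ' : IsPrimitiveRoot ζ' n :=
    IsPrimitiveRoot.of_map_of_injective (f := algebraMap (adjoinPtField K₁ x) F₁) (by exact hζ)
      (algebraMap (adjoinPtField K₁ x) F₁).injective
  have hi' : ∃ i : adjoinPtField K₁ x, i ^ 2 = -1 :=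
    ⟨⟨i₀, mem_adjoinPtField_of_mem_base x hi₀K⟩, Subtype.ext (by simpa using hi₀)⟩
  have hmax : (kummerIdeal n (expGen K₁ x)).IsMaximal :=
    isMaximal_kummerIdeal hζ' hi' (expGen K₁ x) (expGen_ne_zero x) hind
  have hk1 : RingHom.ker (eval₂Hom (algebraMap (adjoinPtField K₁ x) F₁) r) = kummerIdeal n (expGen K₁ x) :=
    ker_eval₂Hom_eq_kummerIdeal _ _ r (fun i => by rw [hr i]; rfl) hmax
  have hk2 : RingHom.ker (eval₂Hom τ r') = kummerIdeal n (expGen K₁ x) :=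
    ker_eval₂Hom_eq_kummerIdeal τ _ r' hr' hmax
  have hiff : ∀ p : MvPolynomial (Fin N) (adjoinPtField K₁ x), aeval r p = 0 ↔ eval₂ τ r' p = 0 := by
    intro p
    have h1 : aeval r p = 0 ↔ p ∈ kummerIdeal n (expGen K₁ x) := by
      rw [← hk1, RingHom.mem_ker]; rfl
    have h2 : eval₂ τ r' p = 0 ↔ p ∈ kummerIdeal n (expGen K₁ x) := by
      rw [← hk2, RingHom.mem_ker]; rfl
    exact h1.trans h2.symm
  exact ⟨pointFieldHom₂ τ r r' hiff, pointFieldHom₂_algebraMap τ r r' hiff,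
    pointFieldHom₂_apply_self τ r r' hiff⟩

/-- **Cross Γ-isomorphisms from level-`0` embeddings of Kummer-generic tuples** (two-field form of
`isGammaIsoTw_of_adjoinPtFieldHom`; Bays–Kirby 2018, Prop. 3.22, proof, case (EXP)). Let `K₁` be
Γ-closed in the algebraically closed `F₁`, and suppose the level-`0` field `L₁ = K₁⁰(x, exp x)`
admits a ring homomorphism `τ : L₁ → F₂` which is `σ` on `K₁⁰` with `τ xᵢ = x'ᵢ`,
`τ (exp xᵢ) = exp x'ᵢ`. If the `exp xᵢ` are independent modulo `n`-th powers in `L₁` for every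
`n ≥ 1`, then `x ↦ x'` is a cross Γ-isomorphism over `σ`.
[cite: BaysKirby2018ANT, Prop. 3.22 (proof, case (EXP)), Def. 3.19] -/
theorem isGammaIsoTw₂_of_adjoinPtFieldHom [IsAlgClosed F₁] (hK : IsGammaClosed K₁)
    (τ : adjoinPtField K₁ x →+* F₂)
    (hτK : ∀ (z : F₁) (hz : z ∈ fieldOf K₁), τ ⟨z, mem_adjoinPtField_of_mem_fieldOf x hz⟩ = σ ⟨z, hz⟩)
    (hτx : ∀ i, τ ⟨x i, apply_mem_adjoinPtField x i⟩ = x' i)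
    (hτe : ∀ i, τ (expGen K₁ x i) = exp (x' i))
    (hind : ∀ n, 0 < n → IndepModPowers n (expGen K₁ x)) :
    IsGammaIsoTw₂ σ x x' := by
  intro M
  set n := M.factorial with hn
  have hnpos : 0 < n := Nat.factorial_pos M
  set r : Fin N → F₁ := fun i => exp (x i / (n : F₁)) with hr
  set r' : Fin N → F₂ := fun i => exp (x' i / (n : F₂)) with hr'
  have hex := exists_ringHom_adjoin_roots₂ hK τ hnpos (hind n hnpos) r r'
    (fun i => exp_div_factorial_pow (x i) M) (fun i => by rw [hτe]; exact exp_div_factorial_pow (x' i) M)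
  set E := IntermediateField.adjoin (adjoinPtField K₁ x) (range r) with hE
  obtain ⟨ψ, hψL, hψr⟩ := hex
  have hmem : ∀ j, lvGens M x j ∈ E := by
    rintro (i | i)
    · exact (IntermediateField.algebraMap_mem E ⟨x i, apply_mem_adjoinPtField x i⟩ : (x i) ∈ E)
    · exact IntermediateField.subset_adjoin _ _ (mem_range_self i)
  let g : Fin N ⊕ Fin N → E := fun j => ⟨lvGens M x j, hmem j⟩
  have hψg : ∀ j, ψ (g j) = lvGens M x' j := by
    rintro (i | i)
    · have : g (Sum.inl i) = algebraMap (adjoinPtField K₁ x) E ⟨x i, apply_mem_adjoinPtField x i⟩ := rfl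
      rw [this, hψL, hτx, lvGens_inl]
    · exact hψr i
  let ιK : fieldOf K₁ →+* E :=
    (algebraMap (adjoinPtField K₁ x) E).comp (algebraMap (fieldOf K₁) (adjoinPtField K₁ x))
  have hψK : ∀ k : fieldOf K₁, ψ (ιK k) = σ k := fun k => by
    show ψ (algebraMap (adjoinPtField K₁ x) E (algebraMap (fieldOf K₁) (adjoinPtField K₁ x) k)) = σ k
    rw [hψL]
    exact hτK k k.2
  exact aeval_lvGens_iff_of_ringHom₂ M ιK (fun _ => rfl) g (fun _ => rfl) ψ hψK hψg

end KummerLevels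

/-! ### Kummer level extension over an arbitrary base, into another field -/

omit [Literature.ModelTheory.ExponentialFields.ExponentialRing F₁]
  [Literature.ModelTheory.ExponentialFields.ExponentialRing F₂] [CharZero F₂] in
/-- **Kummer level extension, into another field.** Let `Ω ≤ F₁` be an intermediate field (over some
`k`) containing all roots of unity of the algebraically closed `F₁`, `τ : Ω → F₂` a ring
homomorphism, and `a₁, …, aₛ ∈ Ωˣ` independent modulo `m`-th powers in `Ω` (`m ≥ 1`). Then for any
`m`-th roots `rᵢ ∈ F₁` of `aᵢ` and `r'ᵢ ∈ F₂` of `τ(aᵢ)`, `τ` extends to `Ω(r) → F₂` with `rᵢ ↦ r'ᵢ`.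
[cite: Lang2002, VI §8 (Thm 8.1)] -/
theorem exists_ringHom_adjoin_roots_of_indepModPowers₂ [IsAlgClosed F₁] {k : Type*} [Field k]
    [Algebra k F₁] (Ω : IntermediateField k F₁)
    (hroots : ∀ (m : ℕ), 0 < m → ∀ ζ : F₁, ζ ^ m = 1 → ζ ∈ Ω)
    (τ : Ω →+* F₂) {m : ℕ} (hm : 0 < m) {s : ℕ} (a : Fin s → Ω) (ha : ∀ i, a i ≠ 0)
    (hind : IndepModPowers m a) (r : Fin s → F₁) (r' : Fin s → F₂) (hr : ∀ i, r i ^ m = (a i : F₁))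
    (hr' : ∀ i, r' i ^ m = τ (a i)) :
    ∃ ψ : IntermediateField.adjoin Ω (range r) →+* F₂,
      (∀ z : Ω, ψ (algebraMap Ω _ z) = τ z) ∧
      ∀ i, ψ ⟨r i, IntermediateField.subset_adjoin _ _ (mem_range_self i)⟩ = r' i := by
  haveI : NeZero m := ⟨hm.ne'⟩
  haveI : NeZero (m : F₁) := ⟨Nat.cast_ne_zero.2 hm.ne'⟩
  obtain ⟨ζ, hζ⟩ := HasEnoughRootsOfUnity.exists_primitiveRoot F₁ m
  have hζΩ : ζ ∈ Ω := hroots m hm ζ hζ.pow_eq_one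
  obtain ⟨i₀, hi₀⟩ := IsAlgClosed.exists_pow_nat_eq (-1 : F₁) (by norm_num : 0 < 2)
  have hi₀Ω : i₀ ∈ Ω := hroots 4 (by norm_num) i₀
    (by rw [show (4 : ℕ) = 2 * 2 from rfl, pow_mul, hi₀]; norm_num)
  let ζ' : Ω := ⟨ζ, hζΩ⟩
  have hζ' : IsPrimitiveRoot ζ' m :=
    IsPrimitiveRoot.of_map_of_injective (f := algebraMap Ω F₁) (by exact hζ) (algebraMap Ω F₁).injective
  have hi' : ∃ i : Ω, i ^ 2 = -1 := ⟨⟨i₀, hi₀Ω⟩, Subtype.ext (by simpa using hi₀)⟩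
  have hmax : (kummerIdeal m a).IsMaximal := isMaximal_kummerIdeal hζ' hi' a ha hind
  have hk1 : RingHom.ker (eval₂Hom (algebraMap Ω F₁) r) = kummerIdeal m a :=
    ker_eval₂Hom_eq_kummerIdeal _ _ r (fun i => by rw [hr i]; rfl) hmax
  have hk2 : RingHom.ker (eval₂Hom τ r') = kummerIdeal m a :=
    ker_eval₂Hom_eq_kummerIdeal τ _ r' hr' hmax
  have hiff : ∀ p : MvPolynomial (Fin s) Ω, aeval r p = 0 ↔ eval₂ τ r' p = 0 := by
    intro p
    have h1 : aeval r p = 0 ↔ p ∈ kummerIdeal m a := by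
      rw [← hk1, RingHom.mem_ker]; rfl
    have h2 : eval₂ τ r' p = 0 ↔ p ∈ kummerIdeal m a := by
      rw [← hk2, RingHom.mem_ker]; rfl
    exact h1.trans h2.symm
  exact ⟨pointFieldHom₂ τ r r' hiff, pointFieldHom₂_algebraMap τ r r' hiff,
    pointFieldHom₂_apply_self τ r r' hiff⟩

/-! ### Cross Γ-isomorphisms from embeddings of `⟨K₁ c⟩(b, exp b)` (relative Kummer theory) -/

section RelativeKummer

/-- **Cross Γ-isomorphisms from embeddings of `⟨K₁ c⟩(b, exp b)`** (two-field form of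
`IsGammaIsoTw.append_of_ringHom_adjoin`; Bays–Kirby 2018, Prop. 3.22 / Def. 3.19). Let `K₁` be
Γ-closed in the algebraically closed `F₁`, `c ↦ c'` a cross Γ-isomorphism over `σ` with field
isomorphism `θ : ⟨K₁ c⟩ ≅ ⟨K₂ c'⟩`, and `τ : ⟨K₁ c⟩(b, exp b) → F₂` a ring homomorphism extending
`θ` with `bⱼ ↦ gⱼ`, `exp bⱼ ↦ exp gⱼ`. If `exp b₁, …, exp bₙ` are independent modulo `m`-th powers
in `⟨K₁ c⟩(b, exp b)` for all `m ≥ 1`, then `(c, b) ↦ (c', g)` is a cross Γ-isomorphism over `σ`.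
[cite: BaysKirby2018ANT, Prop. 3.22 (proof, case (EXP)), Def. 3.19, Lemma 8.3 (proof)] -/
theorem IsGammaIsoTw₂.append_of_ringHom_adjoin [IsAlgClosed F₁] (hK : IsGammaClosed K₁)
    {c : Fin N → F₁} {c' : Fin N → F₂} (h : IsGammaIsoTw₂ σ c c') {b : Fin n → F₁} {g : Fin n → F₂}
    (τ : IntermediateField.adjoin (fieldOf K₁) (allGens c ∪ range (gammaPt b)) →+* F₂)
    (hτE : ∀ (z : F₁) (hz : z ∈ IntermediateField.adjoin (fieldOf K₁) (allGens c)),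
      τ ⟨z, adjoinField_le_adjoin_union c b hz⟩ = (h.fieldEquiv ⟨z, hz⟩ : F₂))
    (hτb : ∀ j, τ ⟨b j, IntermediateField.subset_adjoin _ _ (Or.inr ⟨Sum.inl j, rfl⟩)⟩ = g j)
    (hτe : ∀ j, τ ⟨exp (b j), IntermediateField.subset_adjoin _ _ (Or.inr ⟨Sum.inr j, rfl⟩)⟩ = exp (g j))
    (hind : ∀ m, 0 < m → IndepModPowers m (fun j =>
      (⟨exp (b j), IntermediateField.subset_adjoin _ _ (Or.inr ⟨Sum.inr j, rfl⟩)⟩ :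
        IntermediateField.adjoin (fieldOf K₁) (allGens c ∪ range (gammaPt b))))) :
    IsGammaIsoTw₂ σ (Fin.append c b) (Fin.append c' g) := by
  classical
  intro M
  have hmpos : 0 < M.factorial := Nat.factorial_pos M
  have hroots : ∀ (m : ℕ), 0 < m → ∀ ζ : F₁, ζ ^ m = 1 →
      ζ ∈ IntermediateField.adjoin (fieldOf K₁) (allGens c ∪ range (gammaPt b)) :=
    fun m hm ζ hζ => adjoinField_le_adjoin_union c b (mem_adjoinField_allGens_of_pow_eq_one hK c hm hζ)
  obtain ⟨ψ, hψΩ, hψr⟩ := exists_ringHom_adjoin_roots_of_indepModPowers₂ _ hroots τ hmpos _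
    (fun j h0 => exp_ne_zero (b j) (congrArg Subtype.val h0)) (hind _ hmpos)
    (fun j => exp (b j / (M.factorial : F₁))) (fun j => exp (g j / (M.factorial : F₂)))
    (fun j => exp_div_factorial_pow (b j) M)
    (fun j => by rw [hτe]; exact exp_div_factorial_pow (g j) M)
  have hmem : ∀ s, lvGens M (Fin.append c b) s ∈
      IntermediateField.adjoin (IntermediateField.adjoin (fieldOf K₁) (allGens c ∪ range (gammaPt b)))
        (range fun j : Fin n => exp (b j / (M.factorial : F₁))) := lvGens_append_mem_adjoin_roots (K := K₁) M c b
  have hΩmem : ∀ z : IntermediateField.adjoin (fieldOf K₁) (allGens c ∪ range (gammaPt b)), (z : F₁) ∈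
      IntermediateField.adjoin (IntermediateField.adjoin (fieldOf K₁) (allGens c ∪ range (gammaPt b)))
        (range fun j : Fin n => exp (b j / (M.factorial : F₁))) := fun z => IntermediateField.algebraMap_mem _ z
  have hψΩ' : ∀ z : IntermediateField.adjoin (fieldOf K₁) (allGens c ∪ range (gammaPt b)),
      ψ ⟨z, hΩmem z⟩ = τ z := fun z => hψΩ z
  have hψE : ∀ (z : F₁) (hz : z ∈ IntermediateField.adjoin (fieldOf K₁) (allGens c)),
      ψ ⟨z, hΩmem ⟨z, adjoinField_le_adjoin_union c b hz⟩⟩ = (h.fieldEquiv ⟨z, hz⟩ : F₂) := fun z hz => by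
    rw [hψΩ' ⟨z, adjoinField_le_adjoin_union c b hz⟩, hτE z hz]
  have hψval : ∀ s, ψ ⟨lvGens M (Fin.append c b) s, hmem s⟩ = lvGens M (Fin.append c' g) s := by
    rintro (s | s)
    · refine Fin.addCases (fun i => ?_) (fun j => ?_) s
      · have hci : c i ∈ IntermediateField.adjoin (fieldOf K₁) (allGens c) :=
          IntermediateField.subset_adjoin _ _ (mem_iUnion.2 ⟨0, Sum.inl i, rfl⟩)
        have e1 : (⟨lvGens M (Fin.append c b) (Sum.inl (Fin.castAdd n i)), hmem _⟩ :
            IntermediateField.adjoin (IntermediateField.adjoin (fieldOf K₁) (allGens c ∪ range (gammaPt b)))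
              (range fun j : Fin n => exp (b j / (M.factorial : F₁)))) =
            ⟨c i, hΩmem ⟨c i, adjoinField_le_adjoin_union c b hci⟩⟩ := Subtype.ext (by simp [lvGens])
        rw [e1, hψE (c i) hci, lvGens_inl, Fin.append_left]
        exact h.coe_fieldEquiv_apply i hci
      · have e1 : (⟨lvGens M (Fin.append c b) (Sum.inl (Fin.natAdd N j)), hmem _⟩ :
            IntermediateField.adjoin (IntermediateField.adjoin (fieldOf K₁) (allGens c ∪ range (gammaPt b)))
              (range fun j : Fin n => exp (b j / (M.factorial : F₁)))) =
            ⟨b j, hΩmem ⟨b j, IntermediateField.subset_adjoin _ _ (Or.inr ⟨Sum.inl j, rfl⟩)⟩⟩ :=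
          Subtype.ext (by simp [lvGens])
        rw [e1, hψΩ' ⟨b j, IntermediateField.subset_adjoin _ _ (Or.inr ⟨Sum.inl j, rfl⟩)⟩, hτb, lvGens_inl,
          Fin.append_right]
    · refine Fin.addCases (fun i => ?_) (fun j => ?_) s
      · have hci : exp (c i / (M.factorial : F₁)) ∈ IntermediateField.adjoin (fieldOf K₁) (allGens c) :=
          IntermediateField.subset_adjoin _ _ (mem_iUnion.2 ⟨M, Sum.inr i, rfl⟩)
        have e1 : (⟨lvGens M (Fin.append c b) (Sum.inr (Fin.castAdd n i)), hmem _⟩ :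
            IntermediateField.adjoin (IntermediateField.adjoin (fieldOf K₁) (allGens c ∪ range (gammaPt b)))
              (range fun j : Fin n => exp (b j / (M.factorial : F₁)))) =
            ⟨exp (c i / (M.factorial : F₁)), hΩmem ⟨_, adjoinField_le_adjoin_union c b hci⟩⟩ :=
          Subtype.ext (by simp [lvGens])
        rw [e1, hψE _ hci, lvGens_inr, Fin.append_left]
        exact h.coe_fieldEquiv_exp_div M i hci
      · have e1 : (⟨lvGens M (Fin.append c b) (Sum.inr (Fin.natAdd N j)), hmem _⟩ :
            IntermediateField.adjoin (IntermediateField.adjoin (fieldOf K₁) (allGens c ∪ range (gammaPt b)))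
              (range fun j : Fin n => exp (b j / (M.factorial : F₁)))) =
            ⟨exp (b j / (M.factorial : F₁)), IntermediateField.subset_adjoin _ _ (mem_range_self j)⟩ :=
          Subtype.ext (by simp [lvGens])
        rw [e1, hψr j, lvGens_inr, Fin.append_right]
  have hKmem : ∀ k : fieldOf K₁, (k : F₁) ∈ IntermediateField.adjoin (fieldOf K₁) (allGens c) := fun k =>
    IntermediateField.algebraMap_mem _ k
  let ιK : fieldOf K₁ →+* IntermediateField.adjoin
      (IntermediateField.adjoin (fieldOf K₁) (allGens c ∪ range (gammaPt b)))
      (range fun j : Fin n => exp (b j / (M.factorial : F₁))) :=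
    (algebraMap (IntermediateField.adjoin (fieldOf K₁) (allGens c ∪ range (gammaPt b))) _).comp
      (algebraMap (fieldOf K₁) (IntermediateField.adjoin (fieldOf K₁) (allGens c ∪ range (gammaPt b))))
  have hιK : ∀ k : fieldOf K₁, ιK k = ⟨k, hΩmem ⟨k, adjoinField_le_adjoin_union c b (hKmem k)⟩⟩ := fun k => rfl
  have hψK : ∀ k : fieldOf K₁, ψ (ιK k) = σ k := fun k => by
    rw [hιK, hψE (k : F₁) (hKmem k)]
    exact h.coe_fieldEquiv_algebraMap k
  let gv : Fin (N + n) ⊕ Fin (N + n) → IntermediateField.adjoin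
      (IntermediateField.adjoin (fieldOf K₁) (allGens c ∪ range (gammaPt b)))
      (range fun j : Fin n => exp (b j / (M.factorial : F₁))) := fun s => ⟨lvGens M (Fin.append c b) s, hmem s⟩
  exact aeval_lvGens_iff_of_ringHom₂ M ιK (fun _ => rfl) gv (fun _ => rfl) ψ hψK hψval

end RelativeKummer

/-! ### The logarithmic step over `σ`, across two fields (Γ-closed base) -/

section LogStep

/-- **Level-`0` relations of `(c, d)` and `(c', d')` correspond over `σ`, across two fields**
(two-field form of `IsGammaIsoTw.aeval_lvGens_zero_append_single_iff`): `exp d` integral over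
`⟨K₁ c⟩`, `exp d'` a root of `θ(minpoly (exp d))`, `d`, `d'` transcendental over
`K₁⁰[c, exp c, exp d]`, `K₂⁰[c', exp c', exp d']`. [cite: BaysKirby2018ANT, §4.4 (Thm 4.17, proof)] -/
theorem IsGammaIsoTw₂.aeval_lvGens_zero_append_single_iff {c : Fin N → F₁} {c' : Fin N → F₂}
    (h : IsGammaIsoTw₂ σ c c') {d : F₁} {d' : F₂}
    (hyi : IsIntegral (IntermediateField.adjoin (fieldOf K₁) (allGens c)) (exp d))
    (hY : Polynomial.eval₂ ((algebraMap (IntermediateField.adjoin (fieldOf K₂) (allGens c')) F₂).comp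
      h.fieldEquiv.toRingHom) (exp d')
        (minpoly (IntermediateField.adjoin (fieldOf K₁) (allGens c)) (exp d)) = 0)
    (hd : d ∉ acl (insert (exp d) (gens (K₁ ⊔ Submodule.span ℚ (range c)))))
    (hd' : d' ∉ acl (insert (exp d') (gens (K₂ ⊔ Submodule.span ℚ (range c')))))
    (P : MvPolynomial (Fin (N + 1) ⊕ Fin (N + 1)) (fieldOf K₁)) :
    aeval (lvGens 0 (Fin.append c ![d])) P = 0 ↔
      aeval (lvGens 0 (Fin.append c' ![d'])) (MvPolynomial.map (σ : fieldOf K₁ →+* fieldOf K₂) P) = 0 := by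
  have hp := algebraicIndependent_single_of_not_mem_acl (K := K₁) hd
  have hq := algebraicIndependent_single_of_not_mem_acl (K := K₂) hd'
  set ρ : Fin (N + 1) ⊕ Fin (N + 1) → Fin 1 ⊕ (Fin 1 ⊕ (Fin N ⊕ Fin N)) :=
    Sum.elim (Fin.addCases (fun i => Sum.inr (Sum.inr (Sum.inl i))) fun _ => Sum.inl 0)
      (Fin.addCases (fun i => Sum.inr (Sum.inr (Sum.inr i))) fun _ => Sum.inr (Sum.inl 0)) with hρ
  have e1 : aeval (lvGens 0 (Fin.append c ![d])) P =
      aeval (Sum.elim ![d] (Sum.elim ![exp d] (lvGens 0 c))) (rename ρ P) := by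
    rw [aeval_rename, ← lvGens_zero_append_single_eq_comp]
  have e2 : aeval (lvGens 0 (Fin.append c' ![d'])) (MvPolynomial.map (σ : fieldOf K₁ →+* fieldOf K₂) P) =
      aeval (Sum.elim ![d'] (Sum.elim ![exp d'] (lvGens 0 c')))
        (rename ρ (MvPolynomial.map (σ : fieldOf K₁ →+* fieldOf K₂) P)) := by
    rw [aeval_rename, ← lvGens_zero_append_single_eq_comp]
  rw [e1, e2, ← map_rename]
  exact aeval_sumElim_eq_zero_iff_map_of_forall₂ _
    (fun Q => h.aeval_sumElim_single_eq_zero_iff hyi hY 0 Q) hp hq _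

/-- **The logarithmic step over `σ` for a Kummer-normalised tuple, across two fields** (two-field
form of `IsGammaIsoTw.append_single_of_indepModPowers`): in the situation of
`aeval_lvGens_zero_append_single_iff`, if `K₁` is Γ-closed in the algebraically closed `F₁` and the
exponentials of `(c, d)` are Kummer-independent in `K₁⁰(c, d, exp c, exp d)`, then
`(c, d) ↦ (c', d')` is a cross Γ-isomorphism over `σ`. [cite: BaysKirby2018ANT, Prop. 3.22, §4.4 (Thm 4.17, proof)] -/
theorem IsGammaIsoTw₂.append_single_of_indepModPowers [IsAlgClosed F₁] (hK : IsGammaClosed K₁)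
    {c : Fin N → F₁} {c' : Fin N → F₂} (h : IsGammaIsoTw₂ σ c c') {d : F₁} {d' : F₂}
    (hyi : IsIntegral (IntermediateField.adjoin (fieldOf K₁) (allGens c)) (exp d))
    (hY : Polynomial.eval₂ ((algebraMap (IntermediateField.adjoin (fieldOf K₂) (allGens c')) F₂).comp
      h.fieldEquiv.toRingHom) (exp d')
        (minpoly (IntermediateField.adjoin (fieldOf K₁) (allGens c)) (exp d)) = 0)
    (hd : d ∉ acl (insert (exp d) (gens (K₁ ⊔ Submodule.span ℚ (range c)))))
    (hd' : d' ∉ acl (insert (exp d') (gens (K₂ ⊔ Submodule.span ℚ (range c')))))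
    (hind : ∀ m, 0 < m → IndepModPowers m (expGen K₁ (Fin.append c ![d]))) :
    IsGammaIsoTw₂ σ (Fin.append c ![d]) (Fin.append c' ![d']) := by
  set x := Fin.append c ![d] with hx
  set x' := Fin.append c' ![d'] with hx'
  have hiff : ∀ p : MvPolynomial (Fin (N + 1) ⊕ Fin (N + 1)) (fieldOf K₁),
      aeval (lvGens 0 x) p = 0 ↔
        eval₂ ((algebraMap (fieldOf K₂) F₂).comp (σ : fieldOf K₁ →+* fieldOf K₂)) (lvGens 0 x') p = 0 := by
    intro p
    rw [h.aeval_lvGens_zero_append_single_iff hyi hY hd hd' p, aeval_def, eval₂_map]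
  let τ : adjoinPtField K₁ x →+* F₂ :=
    pointFieldHom₂ ((algebraMap (fieldOf K₂) F₂).comp (σ : fieldOf K₁ →+* fieldOf K₂)) (lvGens 0 x)
      (lvGens 0 x') hiff
  refine isGammaIsoTw₂_of_adjoinPtFieldHom hK τ (fun z hz => ?_) (fun i => ?_) (fun i => ?_) hind
  · have := pointFieldHom₂_algebraMap ((algebraMap (fieldOf K₂) F₂).comp (σ : fieldOf K₁ →+* fieldOf K₂))
      (lvGens 0 x) (lvGens 0 x') hiff ⟨z, hz⟩
    exact this
  · have := pointFieldHom₂_apply_self ((algebraMap (fieldOf K₂) F₂).comp (σ : fieldOf K₁ →+* fieldOf K₂))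
      (lvGens 0 x) (lvGens 0 x') hiff (Sum.inl i)
    simpa only [lvGens_inl] using this
  · have := pointFieldHom₂_apply_self ((algebraMap (fieldOf K₂) F₂).comp (σ : fieldOf K₁ →+* fieldOf K₂))
      (lvGens 0 x) (lvGens 0 x') hiff (Sum.inr i)
    have e1 : expGen K₁ x i = ⟨lvGens 0 x (Sum.inr i),
        IntermediateField.subset_adjoin _ _ (mem_range_self (Sum.inr i))⟩ :=
      Subtype.ext (by rw [coe_expGen]; exact (lvGens_zero_inr x i).symm)
    rw [e1, this, lvGens_zero_inr]

/-- **The logarithmic step over `σ` for a Kummer-normalised tuple, existence, across two fields**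
(two-field form of `IsGammaIsoTw.exists_append_single_of_exp_mem_acl_of_indepModPowers`). Let `K₁`
be Γ-closed in the algebraically closed `F₁`, `F₂` algebraically closed with `exp` onto `F₂ˣ`,
`c ↦ c'` a cross Γ-isomorphism over `σ` (an isomorphism of base Γ-fields) with `K₁ + ℚc ◁ F₁`,
`K₂ + ℚc' ◁ F₂`, and `d ∉ K₁ + ℚc` with `exp d` algebraic over `⟨K₁ c⟩` and `(c, d)`
Kummer-normalised. Then there is `d' ∉ K₂ + ℚc'` in `F₂` with `exp d'` algebraic over `⟨K₂ c'⟩` and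
`(c, d) ↦ (c', d')` a cross Γ-isomorphism over `σ`.
[cite: BaysKirby2018ANT, §4.4 (Thm 4.17, proof), Lemma 8.3 (proof)] -/
theorem IsGammaIsoTw₂.exists_append_single_of_exp_mem_acl_of_indepModPowers [IsAlgClosed F₁]
    [IsAlgClosed F₂] (hK : IsGammaClosed K₁) (hsurj : IsSurjectiveOntoUnits F₂) {c : Fin N → F₁}
    {c' : Fin N → F₂} (h : IsGammaIsoTw₂ σ c c') (hσ : IsEBaseIso₂ K₁ K₂ σ)
    (hs : IsStrong (K₁ ⊔ Submodule.span ℚ (range c)))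
    (hs' : IsStrong (K₂ ⊔ Submodule.span ℚ (range c'))) {d : F₁}
    (hdacl : exp d ∈ acl (gens (K₁ ⊔ Submodule.span ℚ (range c))))
    (hdX : d ∉ K₁ ⊔ Submodule.span ℚ (range c))
    (hind : ∀ m, 0 < m → IndepModPowers m (expGen K₁ (Fin.append c ![d]))) :
    ∃ d' : F₂, exp d' ∈ acl (gens (K₂ ⊔ Submodule.span ℚ (range c'))) ∧
      d' ∉ K₂ ⊔ Submodule.span ℚ (range c') ∧
      IsGammaIsoTw₂ σ (Fin.append c ![d]) (Fin.append c' ![d']) := by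
  classical
  set E := IntermediateField.adjoin (fieldOf K₁) (allGens c) with hE
  set E' := IntermediateField.adjoin (fieldOf K₂) (allGens c') with hE'
  set θ : E ≃+* E' := h.fieldEquiv with hθ
  set y := exp d with hy
  have hyi : IsIntegral E y := isIntegral_adjoinField_of_mem_acl hdacl
  set g := minpoly E y with hg
  set g' : Polynomial E' := g.map θ.toRingHom with hg'
  have hgirr : Irreducible g := minpoly.irreducible hyi
  have hg'irr : Irreducible g' := by
    have : Polynomial.mapEquiv θ g = g' := Polynomial.mapEquiv_apply θ g
    rw [← this]
    exact (MulEquiv.irreducible_iff (Polynomial.mapEquiv θ)).2 hgirr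
  have hdeg : (g'.map (algebraMap E' F₂)).degree ≠ 0 := by
    rw [Polynomial.degree_map]
    exact (Polynomial.degree_pos_of_irreducible hg'irr).ne'
  obtain ⟨Y, hYroot⟩ := IsAlgClosed.exists_root _ hdeg
  have hY : Polynomial.eval₂ ((algebraMap E' F₂).comp θ.toRingHom) Y g = 0 := by
    rw [← Polynomial.eval₂_map, ← hg', ← Polynomial.eval_map]
    exact hYroot
  have hYg' : Polynomial.aeval Y g' = 0 := by
    rw [Polynomial.aeval_def, hg', Polynomial.eval₂_map]; exact hY
  have hY0 : Y ≠ 0 := by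
    rintro rfl
    have hdvd : Polynomial.X ∣ g' := by
      rw [Polynomial.X_dvd_iff]
      have h0 : (g'.map (algebraMap E' F₂)).coeff 0 = 0 := by
        rw [Polynomial.coeff_zero_eq_eval_zero]; exact hYroot
      rw [Polynomial.coeff_map] at h0
      exact (algebraMap E' F₂).injective (by rw [h0, map_zero])
    have hg'm : g'.Monic := (minpoly.monic hyi).map _
    have hassoc : Associated Polynomial.X g' := Polynomial.irreducible_X.associated_of_dvd hg'irr hdvd
    have heq : g' = Polynomial.X :=
      (Polynomial.eq_of_monic_of_associated Polynomial.monic_X hg'm hassoc).symm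
    have hgX : g = Polynomial.X := by
      apply Polynomial.map_injective θ.toRingHom θ.toRingHom.injective
      rw [← hg', heq, Polynomial.map_X]
    have := minpoly.aeval E y
    rw [← hg, hgX, Polynomial.aeval_X] at this
    exact exp_ne_zero d this
  obtain ⟨d', hd'Y⟩ := hsurj Y hY0
  have hYalg : IsAlgebraic E' Y := ⟨g', hg'irr.ne_zero, hYg'⟩
  have hd'acl : exp d' ∈ acl (gens (K₂ ⊔ Submodule.span ℚ (range c'))) := by
    rw [hd'Y, ← acl_coe_adjoinField_eq K₂ c']
    exact mem_acl_coe_of_isAlgebraic E' hYalg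
  have hd'X : d' ∉ K₂ ⊔ Submodule.span ℚ (range c') := by
    intro hd'X
    have hYE : Y ∈ E' := by rw [← hd'Y]; exact exp_mem_adjoinField_of_mem hd'X
    have hroot : g'.IsRoot ⟨Y, hYE⟩ := by
      have h1 : algebraMap E' F₂ (Polynomial.aeval (⟨Y, hYE⟩ : E') g') = 0 := by
        rw [← Polynomial.aeval_algebraMap_apply F₂ (⟨Y, hYE⟩ : E') g']; exact hYg'
      have h2 : Polynomial.aeval (⟨Y, hYE⟩ : E') g' = 0 :=
        (algebraMap E' F₂).injective (by rw [h1, map_zero])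
      rwa [Polynomial.coe_aeval_eq_eval] at h2
    have hdeg1 : g'.degree = 1 := Polynomial.degree_eq_one_of_irreducible_of_root hg'irr hroot
    have hdegg : g.degree = 1 := by rw [hg', Polynomial.degree_map] at hdeg1; exact hdeg1
    obtain ⟨e, he⟩ := minpoly.mem_range_of_degree_eq_one E y hdegg
    have hye : y = (e : F₁) := he.symm
    have hge : g = Polynomial.X - Polynomial.C e := by
      rw [hg, hye]; exact minpoly.eq_X_sub_C (B := F₁) e
    have hYe : Y = (θ e : F₂) := by
      have := hYg'
      rw [hg', hge, Polynomial.map_sub, Polynomial.map_X, Polynomial.map_C, map_sub, Polynomial.aeval_X,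
        Polynomial.aeval_C, sub_eq_zero] at this
      exact this
    have hsymm : h.fieldEquiv.symm ⟨Y, hYE⟩ = e := by
      apply h.fieldEquiv.injective
      rw [RingEquiv.apply_symm_apply]
      exact Subtype.ext hYe
    have hexp : (h.fieldEquiv.symm ⟨exp d', exp_mem_adjoinField_of_mem hd'X⟩ : F₁) =
        exp (h.symm.transport d') := by
      rw [h.coe_fieldEquiv_symm_eq]
      exact h.symm.coe_fieldEquiv_exp hσ.symm hd'X _
    have hYeq : (⟨Y, hYE⟩ : E') = ⟨exp d', exp_mem_adjoinField_of_mem hd'X⟩ := Subtype.ext hd'Y.symm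
    rw [hYeq] at hsymm
    rw [hsymm] at hexp
    have ha : h.symm.transport d' ∈ K₁ ⊔ Submodule.span ℚ (range c) := h.symm.transport_mem hσ.symm hd'X
    have hsub : d - h.symm.transport d' ∈ K₁ := hK.sub_mem_of_exp_eq (by rw [← hy, hye, hexp])
    have : d = (d - h.symm.transport d') + h.symm.transport d' := by abel
    rw [this] at hdX
    exact hdX (Submodule.add_mem _ (Submodule.mem_sup_left hsub) ha)
  refine ⟨d', hd'acl, hd'X, h.append_single_of_indepModPowers hK hyi (by rw [hd'Y]; exact hY) ?_ ?_ hind⟩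
  · exact not_mem_acl_of_exp_mem_acl hs hdacl hdX
  · exact not_mem_acl_of_exp_mem_acl hs' hd'acl hd'X

/-- **The logarithmic step over `σ`, across two fields** (two-field form of
`IsGammaIsoTw.exists_append_single_of_exp_mem_acl`; Bays–Kirby 2018, §4.4, proof of Thm 4.17 with
Prop. 3.22). Let `K₁` be Γ-closed in the algebraically closed `F₁`, `F₂` algebraically closed with
`exp` onto `F₂ˣ`, `c ↦ c'` a cross Γ-isomorphism over `σ` with `c` linearly independent over `K₁`,
`K₁ + ℚc ◁ F₁`, `K₂ + ℚc' ◁ F₂`, and `d ∉ K₁ + ℚc` with `exp d` algebraic over `⟨K₁ c⟩`. Then there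
is `d' ∉ K₂ + ℚc'` in `F₂` with `exp d'` algebraic over `⟨K₂ c'⟩` and `(c, d) ↦ (c', d')` a cross
Γ-isomorphism over `σ`. [cite: BaysKirby2018ANT, §4.4 (Thm 4.17, proof), Prop. 3.22, Lemma 8.3 (proof)] -/
theorem IsGammaIsoTw₂.exists_append_single_of_exp_mem_acl [IsAlgClosed F₁] [IsAlgClosed F₂]
    (hK : IsGammaClosed K₁) (hsurj : IsSurjectiveOntoUnits F₂) {c : Fin N → F₁} {c' : Fin N → F₂}
    (h : IsGammaIsoTw₂ σ c c') (hσ : IsEBaseIso₂ K₁ K₂ σ) (hc : LinIndepOver K₁ c)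
    (hs : IsStrong (K₁ ⊔ Submodule.span ℚ (range c)))
    (hs' : IsStrong (K₂ ⊔ Submodule.span ℚ (range c'))) {d : F₁}
    (hdacl : exp d ∈ acl (gens (K₁ ⊔ Submodule.span ℚ (range c))))
    (hdX : d ∉ K₁ ⊔ Submodule.span ℚ (range c)) :
    ∃ d' : F₂, exp d' ∈ acl (gens (K₂ ⊔ Submodule.span ℚ (range c'))) ∧
      d' ∉ K₂ ⊔ Submodule.span ℚ (range c') ∧
      IsGammaIsoTw₂ σ (Fin.append c ![d]) (Fin.append c' ![d']) := by
  classical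
  have hind : LinIndepOver K₁ (Fin.append c ![d]) := hc.append_single hdX
  obtain ⟨ct, et, hct, hcint, het, hint, -, hindep⟩ := exists_normalised_basis hK c ![d] hind
  set d₁ := et 0 with hd₁
  have het1 : et = ![d₁] := by
    funext i; rw [Fin.fin_one_eq_zero i]; rfl
  rw [het1] at het hint hindep
  have hct_mem : ∀ i, ct i ∈ K₁ ⊔ Submodule.span ℚ (range c) := fun i => Submodule.mem_sup_right (hct i)
  have hXt : K₁ ⊔ Submodule.span ℚ (range ct) = K₁ ⊔ Submodule.span ℚ (range c) := by
    apply le_antisymm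
    · exact sup_le le_sup_left (Submodule.span_le.2 (by rintro _ ⟨i, rfl⟩; exact hct_mem i))
    · refine sup_le le_sup_left (Submodule.span_le.2 ?_)
      rintro _ ⟨i, rfl⟩
      obtain ⟨z, hz⟩ := hcint i
      rw [SetLike.mem_coe, hz]
      exact Submodule.sum_mem _ fun l _ =>
        Submodule.smul_mem _ _ (Submodule.mem_sup_right (Submodule.subset_span ⟨l, rfl⟩))
  have hcX : ∀ i, c i ∈ K₁ ⊔ Submodule.span ℚ (range ct) := fun i => by
    rw [hXt]; exact Submodule.mem_sup_right (Submodule.subset_span ⟨i, rfl⟩)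
  have hBt : K₁ ⊔ Submodule.span ℚ (range (Fin.append ct ![d₁])) =
      K₁ ⊔ Submodule.span ℚ (range (Fin.append c ![d])) := by
    apply le_antisymm
    · refine sup_le le_sup_left (Submodule.span_le.2 ?_)
      rintro _ ⟨r, rfl⟩
      refine Fin.addCases (fun i => ?_) (fun j => ?_) r
      · rw [SetLike.mem_coe, Fin.append_left, sup_span_range_append_single]
        exact Submodule.mem_sup_left (hct_mem i)
      · rw [SetLike.mem_coe, Fin.append_right]
        exact Submodule.mem_sup_right (het j)
    · refine sup_le le_sup_left (Submodule.span_le.2 ?_)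
      rintro _ ⟨s, rfl⟩
      obtain ⟨z, hz⟩ := hint s
      rw [SetLike.mem_coe, hz]
      exact Submodule.sum_mem _ fun r _ =>
        Submodule.smul_mem _ _ (Submodule.mem_sup_right (Submodule.subset_span ⟨r, rfl⟩))
  have ht : IsGammaIsoTw₂ σ ct (fun i => h.transport (ct i)) := h.transfer hσ hct_mem
  have hX't : K₂ ⊔ Submodule.span ℚ (range fun i => h.transport (ct i)) =
      K₂ ⊔ Submodule.span ℚ (range c') := h.sup_span_transport_eq hσ hct_mem hcX
  have hst : IsStrong (K₁ ⊔ Submodule.span ℚ (range ct)) := by rw [hXt]; exact hs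
  have hst' : IsStrong (K₂ ⊔ Submodule.span ℚ (range fun i => h.transport (ct i))) := by
    rw [hX't]; exact hs'
  have hdB : d ∈ K₁ ⊔ Submodule.span ℚ (range (Fin.append ct ![d₁])) := by
    rw [hBt]
    have := append_single_mem_sup_span (K := K₁) c d (Fin.natAdd N 0)
    simpa [Fin.append_right] using this
  have hd₁X : d₁ ∉ K₁ ⊔ Submodule.span ℚ (range ct) := by
    intro hd₁X
    have hBle : K₁ ⊔ Submodule.span ℚ (range (Fin.append ct ![d₁])) ≤ K₁ ⊔ Submodule.span ℚ (range ct) := by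
      rw [sup_span_range_append_single]
      exact sup_le le_rfl ((Submodule.span_singleton_le_iff_mem _ _).2 hd₁X)
    rw [hXt] at hBle
    exact hdX (hBle hdB)
  have hd₁acl : exp d₁ ∈ acl (gens (K₁ ⊔ Submodule.span ℚ (range ct))) := by
    rw [hXt]
    obtain ⟨q, hq⟩ := (Submodule.mem_span_range_iff_exists_fun ℚ).1 (het 0)
    have hsplit : d₁ = (∑ i : Fin N, q (Fin.castAdd 1 i) • c i) + q (Fin.natAdd N 0) • d := by
      have h0 : (![d₁] : Fin 1 → F₁) 0 = d₁ := rfl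
      rw [← h0, ← hq, Fin.sum_univ_add]
      simp [Fin.append_left, Fin.append_right]
    rw [hsplit, exp_add]
    refine mul_mem_acl ?_ (exp_smul_mem_acl _ hdacl)
    refine subset_acl _ (exp_mem_gens (Submodule.mem_sup_right ?_))
    exact Submodule.sum_mem _ fun i _ => Submodule.smul_mem _ _ (Submodule.subset_span ⟨i, rfl⟩)
  obtain ⟨D₁, hD₁acl, hD₁X, h₁⟩ :=
    ht.exists_append_single_of_exp_mem_acl_of_indepModPowers hK hsurj hσ hst hst' hd₁acl hd₁X hindep
  have hy : ∀ j, Fin.append c ![d] j ∈ K₁ ⊔ Submodule.span ℚ (range (Fin.append ct ![d₁])) := by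
    intro j; rw [hBt]; exact append_single_mem_sup_span c d j
  have h₂ := h₁.transfer hσ hy
  have hct_memB : ∀ i, ct i ∈ K₁ ⊔ Submodule.span ℚ (range (Fin.append ct ![d₁])) := fun i => by
    have := append_single_mem_sup_span (K := K₁) ct d₁ (Fin.castAdd 1 i)
    rwa [Fin.append_left] at this
  have hagree : ∀ z ∈ K₁ ⊔ Submodule.span ℚ (range c), h₁.transport z = h.transport z := by
    intro z hz
    rw [← hXt] at hz
    have e1 : ht.transport z = h₁.transport z :=
      ht.transport_eq_transport h₁ hct_memB (fun i => by
        have := h₁.transport_apply (Fin.castAdd 1 i)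
        rwa [Fin.append_left, Fin.append_left] at this) hz
    have e2 : ht.transport z = h.transport z :=
      ht.transport_eq_transport h hct_mem (fun _ => rfl) hz
    rw [← e1, e2]
  have hfun : (fun j => h₁.transport (Fin.append c ![d] j)) = Fin.append c' ![h₁.transport d] := by
    funext j
    refine Fin.addCases (fun i => ?_) (fun i => ?_) j
    · rw [Fin.append_left, Fin.append_left,
        hagree _ (Submodule.mem_sup_right (Submodule.subset_span ⟨i, rfl⟩)), h.transport_apply]
    · rw [Fin.append_right, Fin.append_right, Fin.fin_one_eq_zero i]; rfl
  rw [hfun] at h₂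
  refine ⟨h₁.transport d, ?_, ?_, h₂⟩
  · have hd'mem : h₁.transport d ∈
        K₂ ⊔ Submodule.span ℚ (range (Fin.append (fun i => h.transport (ct i)) ![D₁])) :=
      h₁.transport_mem hσ hdB
    rw [sup_span_range_append_single, hX't] at hd'mem
    obtain ⟨x₀, hx₀, w, hw, hsum⟩ := Submodule.mem_sup.1 hd'mem
    obtain ⟨q, rfl⟩ := Submodule.mem_span_singleton.1 hw
    rw [← hsum, exp_add]
    rw [hX't] at hD₁acl
    exact mul_mem_acl (subset_acl _ (exp_mem_gens hx₀)) (exp_smul_mem_acl q hD₁acl)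
  · intro hd'X
    have hback : h₁.symm.transport (h₁.transport d) = d := h₁.transport_symm_transport hσ hdB
    have hct'_memB : ∀ i, h.transport (ct i) ∈
        K₂ ⊔ Submodule.span ℚ (range (Fin.append (fun i => h.transport (ct i)) ![D₁])) := fun i => by
      have := append_single_mem_sup_span (K := K₂) (fun i => h.transport (ct i)) D₁ (Fin.castAdd 1 i)
      rwa [Fin.append_left] at this
    have hct'_mem : ∀ i, h.transport (ct i) ∈ K₂ ⊔ Submodule.span ℚ (range c') := fun i =>
      h.transport_mem hσ (hct_mem i)
    have hz : h₁.transport d ∈ K₂ ⊔ Submodule.span ℚ (range fun i => h.transport (ct i)) := by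
      rw [hX't]; exact hd'X
    have e1 : ht.symm.transport (h₁.transport d) = h₁.symm.transport (h₁.transport d) :=
      ht.symm.transport_eq_transport h₁.symm hct'_memB (fun i => by
        have := h₁.symm.transport_apply (Fin.castAdd 1 i)
        rwa [Fin.append_left, Fin.append_left] at this) hz
    have e2 : ht.symm.transport (h₁.transport d) = h.symm.transport (h₁.transport d) :=
      ht.symm.transport_eq_transport h.symm hct'_mem
        (fun i => h.transport_symm_transport hσ (hct_mem i)) hz
    have hmem : h.symm.transport (h₁.transport d) ∈ K₁ ⊔ Submodule.span ℚ (range c) :=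
      h.symm.transport_mem hσ.symm hd'X
    rw [← e2, e1, hback] at hmem
    exact hdX hmem

end LogStep

end GammaField

end Literature.NumberTheory.Transcendental
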